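import Literature.RepresentationTheory.FiniteGroups.InducedClassFunction
import HarnessLib

/-!
# Transitivity of induction on class functions

Topic `Literature/RepresentationTheory/FiniteGroups`.  Serre, *Linear Representations of
Finite Groups*, §7.1, Remark (3) / §7.2: "induction is transitive: if `H ≤ K ≤ G` then
`Ind_K^G ∘ Ind_H^K = Ind_H^G`".  **Proved** here for the induced class functions `indClassFun`
of `BrauerInduction` (Serre's formula `Ind f(s) = (1/h) ∑_{t ∈ G, t⁻¹st ∈ H} f(t⁻¹st)`):
`indClassFun_indClassFun` (with `H` viewed inside `K` as `H.subgroupOf K`).  This is the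
bookkeeping step that turns "each character of an elementary group is monomial" into Brauer's
Thm. 20 from Thm. 19.

## References

* J.-P. Serre, *Linear Representations of Finite Groups*, GTM 42 (1977), §7.1 Remark (3),
  §7.2 (`SerreLinearRepresentations1977`).
-/

noncomputable section

open scoped BigOperators

namespace Literature.RepresentationTheory.FiniteGroups

variable {G : Type} [Group G] [Fintype G]

/-- A function on `H ≤ G` viewed as a function on `H.subgroupOf K ≤ K` (`H ≤ K`). [folklore] -/
def toSubgroupOf (H K : Subgroup G) (φ : H → ℂ) (x : H.subgroupOf K) : ℂ :=
  φ ⟨(x : K), Subgroup.mem_subgroupOf.mp x.2⟩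

omit [Fintype G] in
/-- The extension by zero from `H.subgroupOf K` to `K`, evaluated at `k : K`, is the extension
by zero from `H` to `G` evaluated at `k : G`. [folklore] -/
theorem extend_toSubgroupOf (H K : Subgroup G) (φ : H → ℂ) (k : K) :
    Function.extend (Subtype.val : H.subgroupOf K → K) (toSubgroupOf H K φ) 0 k =
      Function.extend (Subtype.val : H → G) φ 0 (k : G) := by
  by_cases hk : (k : G) ∈ H
  · have hk' : k ∈ H.subgroupOf K := Subgroup.mem_subgroupOf.mpr hk
    rw [show k = ((⟨k, hk'⟩ : H.subgroupOf K) : K) from rfl, extend_subtypeVal_apply,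
      show ((k : K) : G) = ((⟨(k : G), hk⟩ : H) : G) from rfl, extend_subtypeVal_apply]
    rfl
  · have hk' : k ∉ H.subgroupOf K := fun h => hk (Subgroup.mem_subgroupOf.mp h)
    rw [extend_subtypeVal_of_not_mem _ _ hk', extend_subtypeVal_of_not_mem _ _ hk]

/-- **Transitivity of induction** (Serre §7.1 Remark (3)): for `H ≤ K ≤ G` and `φ : H → ℂ`,
`Ind_K^G (Ind_H^K φ) = Ind_H^G φ`.  Computation:
`(1/|K|) ∑_t [t⁻¹st ∈ K] (1/|H|) ∑_{k ∈ K} φ̃((tk)⁻¹ s (tk)) = (1/|H|) ∑_u φ̃(u⁻¹ s u)`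
(substitute `u = tk`; when `t⁻¹st ∉ K` the inner terms vanish anyway).
[cite: SerreLinearRepresentations1977, §7.1 Remark (3)] -/
theorem indClassFun_indClassFun (H K : Subgroup G) [Fintype K] (hHK : H ≤ K) (φ : H → ℂ) :
    indClassFun K (indClassFun (H.subgroupOf K) (toSubgroupOf H K φ)) = indClassFun H φ := by
  classical
  funext s
  rw [indClassFun_apply, indClassFun_apply]
  -- the inner induced function, extended by zero to `G`, at `u = t⁻¹ s t`
  have hinner : ∀ u : G, Function.extend (Subtype.val : K → G)
      (indClassFun (H.subgroupOf K) (toSubgroupOf H K φ)) 0 u =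
        (Nat.card H : ℂ)⁻¹ * ∑ k : K, Function.extend (Subtype.val : H → G) φ 0 ((k : G)⁻¹ * u * k) := by
    intro u
    by_cases hu : u ∈ K
    · rw [show u = ((⟨u, hu⟩ : K) : G) from rfl, extend_subtypeVal_apply, indClassFun_apply]
      congr 1
      · rw [Nat.card_congr (Subgroup.subgroupOfEquivOfLe hHK).toEquiv]
      · refine Finset.sum_congr rfl fun k _ => ?_
        rw [extend_toSubgroupOf]
        rfl
    · rw [extend_subtypeVal_of_not_mem K _ hu]
      symm
      refine mul_eq_zero_of_right _ (Finset.sum_eq_zero fun k _ => ?_)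
      apply extend_subtypeVal_of_not_mem
      intro h
      apply hu
      have := K.mul_mem (K.mul_mem k.2 (hHK h)) (K.inv_mem k.2)
      simpa [mul_assoc] using this
  simp_rw [hinner]
  -- exchange sums and substitute `u = t k`
  have hcardK : (Nat.card K : ℂ) ≠ 0 := Nat.cast_ne_zero.mpr Nat.card_pos.ne'
  calc (Nat.card K : ℂ)⁻¹ * ∑ t : G, ((Nat.card H : ℂ)⁻¹ *
        ∑ k : K, Function.extend (Subtype.val : H → G) φ 0 ((k : G)⁻¹ * (t⁻¹ * s * t) * k))
      = (Nat.card K : ℂ)⁻¹ * ((Nat.card H : ℂ)⁻¹ *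
          ∑ k : K, ∑ t : G, Function.extend (Subtype.val : H → G) φ 0 ((t * k)⁻¹ * s * (t * k))) := by
        rw [← Finset.mul_sum, Finset.sum_comm]
        congr 2
        refine Finset.sum_congr rfl fun k _ => Finset.sum_congr rfl fun t _ => ?_
        congr 1
        group
    _ = (Nat.card K : ℂ)⁻¹ * ((Nat.card H : ℂ)⁻¹ *
          ∑ _k : K, ∑ u : G, Function.extend (Subtype.val : H → G) φ 0 (u⁻¹ * s * u)) := by
        congr 2
        refine Finset.sum_congr rfl fun k _ => ?_
        exact Fintype.sum_equiv (Equiv.mulRight (k : G)) _ _ fun t => rfl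
    _ = (Nat.card H : ℂ)⁻¹ * ∑ u : G, Function.extend (Subtype.val : H → G) φ 0 (u⁻¹ * s * u) := by
        rw [Finset.sum_const, Finset.card_univ, nsmul_eq_mul, ← Nat.card_eq_fintype_card]
        field_simp

end Literature.RepresentationTheory.FiniteGroups

end
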